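import Summits.Ventures.HodgeRepro2.HostAPI.HCCM
import Summits.Ventures.HodgeRepro2.T6Interface

/-!
# T6Host — the (S4) object on the host carriers (TARGET-T6.md §4 L0, §2 Layer III; README §10.1)

Version 4 (t6-lead g4; t6-p6 ll. 10956 (3) / 10974): `CMVariety.dim_eq : A.dim = 3` DROPPED — `CMVariety K` is the
general «abelian variety with complex multiplication by `K`, in order form» (it serves the corner product's
factors AND B3's host family `Aμ : (K →+* ℂ) → CMVariety M` of dimension `3 · r_i`); the threefold clause of the
factors moves to `CornerProduct.dim_factor`. Otherwise byte-identical to version 3 (t6-lead g3; rulings STATUS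
ll. 5320 / 5353 (4) and the vocabulary ruling of that generation).
Abbreviations of the host-api carriers (`HostAPI.Carriers.*`, package deposited 14:35Z, INBOX l. 34) and the
ONE host datum of the brief's (S4), stated in the HOST'S OWN vocabulary and free of any Weil-cohomology
datum:
* `HQ X i` = `H^i(X(ℂ), ℚ)` (the host's `bettiCohomology`), `H X i` = `H^i(X(ℂ), ℂ)` (`complexBetti`),
  `HC X i` = `ℂ ⊗[ℚ] H^i(X(ℂ), ℚ)`; `pullQ f i` / `pull f i` = `f^*`; `avPullQ` / `avPull` = `f^*` along a
  morphism of abelian varieties; `cupQ h` = the rational cup product, `cup4C` = its four-fold base change;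
  `eigSub act τ` = the `τ`-eigenspace of a field action, `eigC act σ` = the `σ`-eigenspace of the base change
  to `ℂ` of a rational action;
* `CMVariety K` — ONE complex abelian variety with complex multiplication by the CM field `K`,
  in ORDER FORM (an order `O' ⊂ K` acting by endomorphisms, `K = O' ⊗ ℚ`), with the induced `K`-action
  on `H¹(A(ℂ), ℚ)`, one-dimensional `σ`-eigenspaces of its complexification, and the CM type `type`
  read off the host's `IsOfHodgeType` (`type_spec`: `σ ∈ type` iff every `σ`-eigenvector of the order
  action on `H¹(A(ℂ), ℂ)` is of Hodge type `(1,0)`);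
* `CornerProduct K` — the corner product `B = A₁ × A₂ × A₃ × A₄` of the brief's (S4) for a sextic CM field
  `K` with a rank-four face `F`: the four factors (`A`, of the face's types), `B` with its projections `pr`,
  the diagonal order action (`endo`, `endo_pr`), the induced `K`-action on `H¹(B(ℂ), ℚ)` and the splitting
  `H¹(B) = ⊕ pr_i^* H¹(A_i)` (`pull_internal`, `pull_injective`); on it the split Weil classes
  `CornerProduct.weilC ⊂ ℂ ⊗ H⁴(B, ℚ)` (the `ℂ`-span, over the embeddings `σ`, of the four-fold cup
  products of `σ`-eigenvectors — `⊕_σ ⋀⁴ H¹_σ`, Deligne 1982 §4 / Milne 2020 Plain 2.1), their rational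
  points `CornerProduct.weilQ ⊂ H⁴(B, ℚ)` (the brief's `W_F(B) ⊂ H⁴(B, ℚ)`), and the predicate
  `SplitWeilAlgebraic C` = «`W_F(B)` consists of algebraic classes» with the host's `coniveau C.B.X 4 2`
  (the rational classes of coniveau `≥ 2` in `H⁴` — the host's notion of algebraic class, the one its
  `HodgeConjectureFor` uses through `algebraicClasses`).
Nothing is asserted here: no theorem of print, no instance, no display (displays over these carriers live in
the owners' `T6<Sub>HypHost.lean` files, in the lead's `T6HypHost.lean` and `T6HostBetti.lean`). Every Prop
field of the two structures is a property every corner product of the brief has (none is a printed theorem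
asked for free); the Hodge-theoretic structure of `B` itself is NOT a field — the cell reads it, on the
Weil-cohomology side, from the host's `BettiHodgeData` (`T6HostBetti.lean`).
§8(d): uses an L-value-free non-vanishing device: NO.
-/

noncomputable section

open CategoryTheory
open scoped TensorProduct
open HostAPI.Carriers.AlgebraicGeometry.Motives HostAPI.Carriers.AlgebraicGeometry.HodgeTheory
open HostAPI.Carriers.AlgebraicTopology.SingularHomology

namespace Summit.Ventures.HodgeRepro2.T6.Host

/-- `H^i(X(ℂ), ℚ)` of a scheme over `ℂ`: the host's `bettiCohomology X i`, as a `ℚ`-module. -/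
abbrev HQ (X : SchemeOver ℂ) (i : ℕ) : Type := bettiCohomology X i

/-- `H^i(X(ℂ), ℂ)` of a scheme over `ℂ`: the host's `complexBetti X i`, as a `ℂ`-module. -/
abbrev H (X : SchemeOver ℂ) (i : ℕ) : Type := complexBetti X i

/-- `ℂ ⊗[ℚ] H^i(X(ℂ), ℚ)`, the complexification of the rational cohomology. -/
abbrev HC (X : SchemeOver ℂ) (i : ℕ) : Type := ℂ ⊗[ℚ] HQ X i

/-- The morphism of schemes over `ℂ` underlying a morphism of abelian varieties. -/
abbrev avHom {A B : AbelianVariety ℂ} (f : A ⟶ B) : A.X ⟶ B.X := f.hom.hom.hom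

/-- Pull-back `f^*` along a morphism of schemes over `ℂ` on rational Betti cohomology (the host's
`bettiCohomology.map`). -/
abbrev pullQ {X Y : SchemeOver ℂ} (f : X ⟶ Y) (i : ℕ) : HQ Y i →ₗ[ℚ] HQ X i :=
  (bettiCohomology.map f i).hom

/-- Pull-back `f^*` along a morphism of schemes over `ℂ` on complex Betti cohomology (the host's
`singularCohomology.map` along the continuous map of complex points). -/
abbrev pull {X Y : SchemeOver ℂ} (f : X ⟶ Y) (i : ℕ) : H Y i →ₗ[ℂ] H X i :=
  (singularCohomology.map ℂ ℂ (AlgPoints.mapContinuous (L := ℂ) f) i).hom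

/-- Pull-back along a morphism of abelian varieties on rational Betti cohomology. -/
abbrev avPullQ {A B : AbelianVariety ℂ} (f : A ⟶ B) (i : ℕ) : HQ B.X i →ₗ[ℚ] HQ A.X i :=
  pullQ (avHom f) i

/-- Pull-back along a morphism of abelian varieties on complex Betti cohomology. -/
abbrev avPull {A B : AbelianVariety ℂ} (f : A ⟶ B) (i : ℕ) : H B.X i →ₗ[ℂ] H A.X i :=
  pull (avHom f) i

/-- The rational cup product `H^p ⊗ H^q → H^n` (`p + q = n`): the host's `bettiCup`. -/
abbrev cupQ {X : SchemeOver ℂ} {p q n : ℕ} (h : p + q = n) : HQ X p →ₗ[ℚ] HQ X q →ₗ[ℚ] HQ X n :=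
  bettiCup h

/-- The base change to `ℂ` of the cup product `H¹ ⊗ H¹ → H²`. -/
def cupC11 (X : SchemeOver ℂ) : HC X 1 →ₗ[ℂ] HC X 1 →ₗ[ℂ] HC X 2 :=
  LinearMap.BilinMap.baseChange ℂ (cupQ (X := X) (rfl : 1 + 1 = 2))

/-- The base change to `ℂ` of the cup product `H² ⊗ H² → H⁴`. -/
def cupC22 (X : SchemeOver ℂ) : HC X 2 →ₗ[ℂ] HC X 2 →ₗ[ℂ] HC X (2 * 2) :=
  LinearMap.BilinMap.baseChange ℂ (cupQ (X := X) (rfl : 2 + 2 = 2 * 2))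

/-- The four-fold cup product `(a ∪ b) ∪ (c ∪ d)` on `ℂ ⊗ H¹(X(ℂ), ℚ)`, with values in `ℂ ⊗ H⁴`
(`2 * 2` = the degree of the host's `coniveau X (2 * 2) 2`). -/
def cup4C {X : SchemeOver ℂ} (a b c d : HC X 1) : HC X (2 * 2) :=
  cupC22 X (cupC11 X a b) (cupC11 X c d)

/-- The `τ`-eigenspace of a field action `act : M →+* End(V)`: the vectors `v` with `act x v = τ x • v`
for every `x ∈ M`. -/
def eigSub {𝕜 M V : Type} [Field 𝕜] [Field M] [AddCommGroup V] [Module 𝕜 V]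
    (act : M →+* Module.End 𝕜 V) (τ : M →+* 𝕜) : Submodule 𝕜 V :=
  ⨅ x : M, Module.End.eigenspace (act x) (τ x)

/-- The base change to `ℂ` of a rational field action: `x ↦ (act x) ⊗ 1` on `ℂ ⊗[ℚ] V`. -/
def baseChangeAct {M V : Type} [Field M] [AddCommGroup V] [Module ℚ V]
    (act : M →+* Module.End ℚ V) : M →+* Module.End ℂ (ℂ ⊗[ℚ] V) :=
  (Module.End.baseChangeHom ℚ ℂ V).toRingHom.comp act

/-- The `σ`-eigenspace (`σ : M →+* ℂ`) of the complexification of a rational action on `H^i(X(ℂ), ℚ)`. -/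
abbrev eigC {M : Type} [Field M] {X : SchemeOver ℂ} {i : ℕ} (act : M →+* Module.End ℚ (HQ X i))
    (σ : M →+* ℂ) : Submodule ℂ (HC X i) :=
  eigSub (baseChangeAct act) σ

/-- A complex abelian variety `A` with complex multiplication by the CM field `K`, in order form:
an order `O' ⊂ K` (`K = O' ⊗ ℚ`, `exists_natCast_mul_mem`) acts on `A` by endomorphisms (`endo`); `act` = the
induced action of `K` on `H¹(A(ℂ), ℚ)` (`act_endo`: on `O'` it is the pull-back along `endo`); every
`σ`-eigenspace of its complexification is a line (`finrank_eig`; `H¹(A, ℚ)` is a one-dimensional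
`K`-vector space); `type` = the CM type of `(A, endo)`, the set of embeddings `σ` whose `σ`-eigenvectors in
`H¹(A(ℂ), ℂ)` are of Hodge type `(1,0)` (`type_spec`, with the host's `IsOfHodgeType`). No field asserts a
printed theorem; every field is a property of a CM abelian variety of type `type` (Shimura 1998 §I.3,
Lang 1983 Ch. 1 §3). -/
structure CMVariety (K : Type) [Field K] [NumberField K] [NumberField.IsCMField K] where
  /-- The abelian variety over `ℂ`. -/
  A : AbelianVariety ℂ
  /-- `A` is smooth projective of dimension `A.dim`. -/
  smooth : IsSmoothProjective A.dim A.X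
  /-- The CM type of `(A, endo)`. -/
  type : Set (K →+* ℂ)
  /-- The order of `K` acting on `A`. -/
  O' : Subring K
  /-- The action of the order by endomorphisms of the abelian variety `A`. -/
  endo : O' →+* End A
  /-- `O'` is an order: every element of `K` has a positive integer multiple in `O'`. -/
  exists_natCast_mul_mem : ∀ x : K, ∃ n : ℕ, 0 < n ∧ (n : K) * x ∈ O'
  /-- The induced action of `K` on `H¹(A(ℂ), ℚ)`. -/
  act : K →+* Module.End ℚ (HQ A.X 1)
  /-- On the order, `act` is the pull-back along the endomorphisms. -/
  act_endo : ∀ x : O', act x = avPullQ (endo x) 1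
  /-- Every `σ`-eigenspace of the complexified action is one-dimensional. -/
  finrank_eig : ∀ σ : K →+* ℂ, Module.finrank ℂ (eigC act σ) = 1
  /-- `σ ∈ type` iff every `σ`-eigenvector of the order action on `H¹(A(ℂ), ℂ)` is of Hodge type `(1,0)`. -/
  type_spec : ∀ σ : K →+* ℂ, σ ∈ type ↔
    ∀ c : H A.X 1, (∀ x : O', avPull (endo x) 1 c = σ x • c) → IsOfHodgeType A.dim A.X 1 1 0 c

/-- A corner product of the brief's (S4) over a sextic CM field `K` with a rank-four face `F`: four CM
abelian threefolds `A i` of the face's types `F.T i` (`type_factor`, `dim_factor`), their product `B` (a twelve-dimensional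
complex abelian variety) with the projections `pr i`, the diagonal action of a common order `O'` of `K`
(`O'_le`, `endo`, `endo_pr`: the projections are `O'`-equivariant), the induced `K`-action on
`H¹(B(ℂ), ℚ)` (`act_endo`) and the splitting `H¹(B) = ⊕_i pr_i^* H¹(A_i)` (`pull_internal`,
`pull_injective` — what «`B = A₁ × A₂ × A₃ × A₄`» says on the host carriers, which carry no product of
schemes). No field asserts a printed theorem; every field is a property of the product of the four
factors. -/
structure CornerProduct (K : Type) [Field K] [NumberField K] [NumberField.IsCMField K] where
  /-- The face setting (sextic, the four CM types `T`, `IsWeilFace`). -/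
  F : FaceSetting K
  /-- The four factors. -/
  A : Fin 4 → CMVariety K
  /-- The `i`-th factor has the CM type of the `i`-th vertex of the face. -/
  type_factor : ∀ i, (A i).type = F.T i
  /-- Each factor is a threefold. -/
  dim_factor : ∀ i, (A i).A.dim = 3
  /-- The corner product `B = A₁ × A₂ × A₃ × A₄`. -/
  B : AbelianVariety ℂ
  /-- `B` is smooth projective of dimension `B.dim`. -/
  smooth : IsSmoothProjective B.dim B.X
  /-- `dim B = 12`. -/
  dim_eq : B.dim = 12
  /-- The projections onto the factors. -/
  pr : ∀ i, (B ⟶ (A i).A)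
  /-- A common order of `K` acting diagonally. -/
  O' : Subring K
  /-- The common order lies in the order of each factor. -/
  O'_le : ∀ i, O' ≤ (A i).O'
  /-- The diagonal action of the order by endomorphisms of `B`. -/
  endo : O' →+* End B
  /-- `O'` is an order: every element of `K` has a positive integer multiple in `O'`. -/
  exists_natCast_mul_mem : ∀ x : K, ∃ n : ℕ, 0 < n ∧ (n : K) * x ∈ O'
  /-- The projections intertwine the diagonal action with the factors' actions. -/
  endo_pr : ∀ (i : Fin 4) (x : O'), endo x ≫ pr i = pr i ≫ (A i).endo ⟨x, O'_le i x.2⟩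
  /-- The induced action of `K` on `H¹(B(ℂ), ℚ)`. -/
  act : K →+* Module.End ℚ (HQ B.X 1)
  /-- On the order, `act` is the pull-back along the endomorphisms. -/
  act_endo : ∀ x : O', act x = avPullQ (endo x) 1
  /-- `H¹(B(ℂ), ℚ) = ⊕_i pr_i^* H¹(A_i(ℂ), ℚ)`. -/
  pull_internal : DirectSum.IsInternal (fun i : Fin 4 => LinearMap.range (avPullQ (pr i) 1))
  /-- Each `pr_i^*` is injective on `H¹`. -/
  pull_injective : ∀ i, Function.Injective (avPullQ (pr i) 1)

namespace CornerProduct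

variable {K : Type} [Field K] [NumberField K] [NumberField.IsCMField K] (C : CornerProduct K)

/-- The `σ`-eigenspace of the complexified `K`-action on `ℂ ⊗ H¹(B(ℂ), ℚ)`. -/
abbrev eig (σ : K →+* ℂ) : Submodule ℂ (HC C.B.X 1) := eigC C.act σ

/-- The split Weil classes of the corner product, complexified: the `ℂ`-span, over all embeddings `σ`, of
the four-fold cup products of `σ`-eigenvectors (= `⨁_σ ⋀⁴ H¹_σ` pushed into `ℂ ⊗ H⁴(B, ℚ)` by the cup
product — Deligne 1982 §4, Milne 2020 Plain 2.1, TIER3 §1.12). -/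
def weilC : Submodule ℂ (HC C.B.X (2 * 2)) :=
  ⨆ σ : K →+* ℂ, Submodule.span ℂ
    {w | ∃ v : Fin 4 → HC C.B.X 1, (∀ i, v i ∈ C.eig σ) ∧ w = cup4C (v 0) (v 1) (v 2) (v 3)}

/-- The rational split Weil classes `W_F(B) ⊂ H⁴(B(ℂ), ℚ)`: the rational classes whose complexification
`1 ⊗ c` lies in `weilC` (the brief's (S4): «the `F`-line of split Weil classes `W_F(B) ⊂ H(B, ℚ)`»). -/
def weilQ : Submodule ℚ (HQ C.B.X (2 * 2)) :=
  (C.weilC.restrictScalars ℚ).comap (TensorProduct.mk ℚ ℂ (HQ C.B.X (2 * 2)) 1)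

end CornerProduct

/-- «The split Weil classes of the corner product `C` are algebraic»: every rational split Weil class is a
class of coniveau `≥ 2` in `H⁴(B(ℂ), ℚ)` — the host's `coniveau C.B.X 4 2`, the host's notion of a rational
algebraic class (its `HodgeConjectureFor` uses the same notion, `algebraicClasses X 2 = supportedClasses X 4 2`,
on `H⁴(B(ℂ), ℂ)`). The conclusion of Theorem A on the host carriers; the antecedent of the brief's (S4). -/
def SplitWeilAlgebraic {K : Type} [Field K] [NumberField K] [NumberField.IsCMField K]
    (C : CornerProduct K) : Prop :=
  C.weilQ ≤ coniveau C.B.X (2 * 2) 2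

end Summit.Ventures.HodgeRepro2.T6.Host

end
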